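import Summits.NavierStokesRegularity.NavierStokesRegularity.Theorems.LerayQuarterDissipationFiniteDissipationLiouvilleBlowdownLeaf
import Summits.NavierStokesRegularity.NavierStokesRegularity.Theorems.LerayQuarterDissipationFiniteDissipationLiouvilleLThreeCorner
import Summits.NavierStokesRegularity.NavierStokesRegularity.Theorems.LerayQuarterDissipationFiniteDissipationLiouvilleStubSmallDissipationGap
import Summits.NavierStokesRegularity.NavierStokesRegularity.Theorems.DssFarFieldSlavingBlowupTypeIDssProfileSimilarityEnstrophyTimeOnlyThreshold
import HarnessLib

/-!
# `FiniteDissipationLiouville`, line `birth`: portrait of a counterexample to the DSS stub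
# (the Edisonian census of the wall, kernel-checked)

Crux `Summit.NavierStokesRegularity.NavierStokesRegularity.Theses.LerayQuarterDissipation.FiniteDissipationLiouville`
(item stmt-NavierStokesRegularity-22144), route LerayQuarterDissipation, line `birth`, lead prover
ns-lqd-lead g2. NS regularity is NOT proved by anything here; no summit is.

The line's registered open stub is the catalogued wall `∀ c > 1, TypeIDSSLiouville c`
(Bradshaw–Tsai 2017 OP 5.1), which is NECESSARY for the crux (seat ns-lqd-p1,
`typeIDSSLiouvilleConjecture_of_finiteDissipationLiouville`, p588754) and, together with the
past-wandering stub, SUFFICIENT (skeleton v4). This file assembles, as ONE theorem, everything the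
landed leaves say a counterexample to the repaired DSS stub must look like: a member `w` of the
finite-dissipation Type-I ancient mild stratum (`IsTypeIAncientMild C w`, quarter law with constant
`K`), `c`-DSS on the past for some `c > 1`, and SINGULAR at the apex, necessarily has

1. `0 < K` (for `K ≤ 0` the `L⁶` slice bound `‖w(t)‖₆ ≤ C_L √(K⁺/√(−t))` of `memLp_six_slice`
   vanishes; cf. the disprover's corner `Negative.eq_zero_of_dissLaw_nonpos`), indeed `K₀ < K` for
   the absolute gap constant of `stub_smallDissipationGap` (stated through the gap property);
2. `ε₀ < C` for every small-Type-I-constant threshold `ε₀` (stated through the threshold property;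
   the disprover's `Negative.fdl_of_small_typeI_constant` supplies an absolute one — not imported
   here to keep this file out of the route's theses cone);
3. `c₁(w) ≤ c` for its Chae–Wolf threshold `c₁(w) > 1` (`exists_pastDss_threshold`);
4. EVERY slice of infinite `L³(ℝ³)` norm (`eq_zero_of_pastDss_of_eLpNorm_three_lt_top`, AB 2019 Thm 1.2);
5. EVERY slice of infinite energy (`eq_zero_of_pastDss_of_eLpNorm_two_lt_top`);
6. global scaled energy `(−s)^{-1/2}∫|w(s)|²` unbounded along EVERY backward sequence
   (`eq_zero_of_scaledEnergy_le_backward`);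
7. a NONZERO blow-down at EVERY slice (`eq_zero_of_pastDss_of_blowdown_tendsto_zero`, AB 2019 Thm 4.1);
8. some non-axisymmetric slice (`eq_zero_of_pastDss_of_isAxisymmetric`, KNSS 2009 Thm 5.3).

No new analysis: contrapositives of landed theorems, collected for the planners and the disprover.
-/

noncomputable section

open MeasureTheory Set Function Filter
open scoped Topology ENNReal NNReal RealInnerProductSpace

namespace Summit.NavierStokesRegularity.NavierStokesRegularity.Theorems.FiniteDissipationLiouville.Birth

open Literature.Analysis.FluidPDE

-- the problem-side namespace duplicates `NavierStokesRegularity` by design (summit = problem)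
set_option linter.dupNamespace false

/-- A singular field is not identically zero on the past (the apex clause at `r = 1`, `M = 0`). -/
theorem not_forall_eq_zero_of_singular
    {w : ℝ → EuclideanSpace ℝ (Fin 3) → EuclideanSpace ℝ (Fin 3)}
    (hsing : ∀ r > 0, ∀ M : ℝ, ∃ t ∈ Set.Ioo (-(r ^ 2)) (0 : ℝ),
      ∃ x ∈ Metric.ball (0 : EuclideanSpace ℝ (Fin 3)) r, M < ‖w t x‖) :
    ¬ ∀ t < 0, ∀ x, w t x = 0 := by
  intro hz
  obtain ⟨t, ht, x, -, hM⟩ := hsing 1 one_pos 0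
  rw [hz t ht.2 x, norm_zero] at hM
  exact lt_irrefl _ hM

/-- **The corner `K ≤ 0` through the `L⁶` slice bound**: a member of the stratum with
non-positive dissipation constant vanishes on the past, since `‖w(t)‖₆ ≤ C_L √(max K 0/√(−t)) = 0`
(`memLp_six_slice`) and the slices are continuous. (The disprover's
`Negative.eq_zero_of_dissLaw_nonpos` proves the same through slice-constancy; this version keeps
the present file route-independent.) -/
theorem eq_zero_of_dissLaw_const_nonpos {C K : ℝ}
    {w : ℝ → EuclideanSpace ℝ (Fin 3) → EuclideanSpace ℝ (Fin 3)} (hw : IsTypeIAncientMild C w)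
    (hD : ∀ s : ℝ, s < 0 → ∫⁻ x, ‖fderiv ℝ (w s) x‖ₑ ^ 2 ≤ ENNReal.ofReal (K / Real.sqrt (-s)))
    (hK : K ≤ 0) : ∀ t < 0, ∀ x, w t x = 0 := by
  obtain ⟨CL, -, hsix⟩ := memLp_six_slice
  intro t ht
  obtain ⟨hmem, h6⟩ := hsix C K w hw hD t ht
  have hmax : max K 0 = 0 := max_eq_right hK
  rw [hmax, zero_div, Real.sqrt_zero, mul_zero] at h6
  -- `∫ ‖w t x‖^6 = 0`
  have hint : Integrable (fun x => ‖w t x‖ ^ (6 : ℝ)) volume := by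
    have := hmem.integrable_norm_rpow (by norm_num) (by norm_num)
    simpa [ENNReal.toReal_ofNat] using this
  have hnn : 0 ≤ ∫ x, ‖w t x‖ ^ (6 : ℝ) := integral_nonneg fun x => by positivity
  have hI0 : ∫ x, ‖w t x‖ ^ (6 : ℝ) = 0 := by
    have h1 : (∫ x, ‖w t x‖ ^ (6 : ℝ)) ^ (1 / 6 : ℝ) = 0 :=
      le_antisymm h6 (Real.rpow_nonneg hnn _)
    rcases (Real.rpow_eq_zero_iff_of_nonneg hnn).1 h1 with ⟨h2, -⟩
    exact h2
  have hae : (fun x => ‖w t x‖ ^ (6 : ℝ)) =ᵐ[volume] 0 :=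
    (integral_eq_zero_iff_of_nonneg (fun x => by positivity) hint).1 hI0
  -- continuity upgrades a.e. to everywhere
  have hcont : Continuous fun x => ‖w t x‖ ^ (6 : ℝ) :=
    (hw.continuous_slice ht).norm.rpow_const fun _ => Or.inr (by norm_num)
  have hall : (fun x => ‖w t x‖ ^ (6 : ℝ)) = 0 := (hcont.ae_eq_iff_eq volume continuous_const).1 hae
  intro x
  have hx : ‖w t x‖ ^ (6 : ℝ) = 0 := congrFun hall x
  rw [Real.rpow_eq_zero_iff_of_nonneg (norm_nonneg _)] at hx
  exact norm_eq_zero.1 hx.1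

/-- **Portrait of a counterexample to the (repaired) DSS stub of line `birth`** — the Edisonian
census of the Type-I DSS wall on the finite-dissipation stratum, as one kernel-checked statement.
Let `w` be a Type-I ancient mild field in the KNSS gauge (constant `C`) with the quarter-rate
dissipation law (constant `K`), `c`-discretely self-similar on the past (`1 < c`), and singular at
the apex. Then: (1) the gap property of any `K₀` fails at `K`, in particular `0 < K`; (2) `C`
exceeds the absolute small-constant threshold; (3) `c` is at least the member's Chae–Wolf
threshold `c₁(w) > 1`; (4) every slice has infinite `L³` norm; (5) every slice has infinite
energy; (6) the global scaled energy is unbounded along every sequence of times `→ −∞`; (7) no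
slice has trivial Navier–Stokes blow-down; (8) not every slice is axisymmetric. -/
theorem pastDss_singular_portrait {C K c : ℝ}
    {w : ℝ → EuclideanSpace ℝ (Fin 3) → EuclideanSpace ℝ (Fin 3)} (hw : IsTypeIAncientMild C w)
    (hD : ∀ s : ℝ, s < 0 → ∫⁻ x, ‖fderiv ℝ (w s) x‖ₑ ^ 2 ≤ ENNReal.ofReal (K / Real.sqrt (-s)))
    (hc : 1 < c) (hpast : ∀ t : ℝ, t < 0 → ∀ x, c • w (c ^ 2 * t) (c • x) = w t x)
    (hsing : ∀ r > 0, ∀ M : ℝ, ∃ t ∈ Set.Ioo (-(r ^ 2)) (0 : ℝ),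
      ∃ x ∈ Metric.ball (0 : EuclideanSpace ℝ (Fin 3)) r, M < ‖w t x‖) :
    -- (1) the dissipation constant is above every gap constant, in particular positive
    (0 < K ∧ ∀ K₀ : ℝ, (∀ (C' K' : ℝ)
        (v : ℝ → EuclideanSpace ℝ (Fin 3) → EuclideanSpace ℝ (Fin 3)), K' ≤ K₀ →
        IsTypeIAncientMild C' v →
        (∀ s : ℝ, s < 0 → ∫⁻ x, ‖fderiv ℝ (v s) x‖ₑ ^ 2 ≤ ENNReal.ofReal (K' / Real.sqrt (-s))) →
        ∀ t < 0, ∀ x, v t x = 0) → K₀ < K) ∧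
    -- (2) the Type-I constant is above the absolute small-constant threshold
    (∀ ε₀ : ℝ, (∀ (C' K' : ℝ) (v : ℝ → EuclideanSpace ℝ (Fin 3) → EuclideanSpace ℝ (Fin 3)),
        C' ≤ ε₀ → IsTypeIAncientMild C' v →
        (∀ s : ℝ, s < 0 → ∫⁻ x, ‖fderiv ℝ (v s) x‖ₑ ^ 2 ≤ ENNReal.ofReal (K' / Real.sqrt (-s))) →
        ¬ (∀ r > 0, ∀ M : ℝ, ∃ t ∈ Set.Ioo (-(r ^ 2)) (0 : ℝ),
            ∃ x ∈ Metric.ball (0 : EuclideanSpace ℝ (Fin 3)) r, M < ‖v t x‖)) → ε₀ < C) ∧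
    -- (3) the scaling factor is at least the member's near-one threshold
    (∃ c₁ : ℝ, 1 < c₁ ∧ c₁ ≤ c) ∧
    -- (4) every slice has infinite L³ norm
    (∀ t < 0, eLpNorm (w t) 3 volume = ⊤) ∧
    -- (5) every slice has infinite energy
    (∀ t < 0, eLpNorm (w t) 2 volume = ⊤) ∧
    -- (6) the global scaled energy is unbounded along every backward sequence
    (∀ (τ : ℕ → ℝ) (E : ℝ), Tendsto τ atTop atBot → (∀ k, τ k < 0) →
        ¬ ∀ k, ∫⁻ x, ‖w (τ k) x‖ₑ ^ 2 ≤ ENNReal.ofReal (E * Real.sqrt (-τ k))) ∧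
    -- (7) no slice has trivial blow-down
    (∀ t₀ < 0, ¬ ∀ φ : EuclideanSpace ℝ (Fin 3) → EuclideanSpace ℝ (Fin 3),
        Literature.Analysis.FunctionSpaces.IsTestFunctionOn
            (⊤ : TopologicalSpace.Opens (EuclideanSpace ℝ (Fin 3))) φ →
          Tendsto (fun lam : ℝ => ∫ x, ⟪lam • w t₀ (lam • x), φ x⟫) atTop (𝓝 0)) ∧
    -- (8) not every slice is axisymmetric
    (¬ ∀ t < 0, IsAxisymmetric (w t)) := by
  have hnz : ¬ ∀ t < 0, ∀ x, w t x = 0 := not_forall_eq_zero_of_singular hsing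
  refine ⟨⟨?_, ?_⟩, ?_, ?_, ?_, ?_, ?_, ?_, ?_⟩
  · -- (1a) `0 < K`
    by_contra hK
    exact hnz (eq_zero_of_dissLaw_const_nonpos hw hD (not_lt.1 hK))
  · -- (1b) above every gap constant
    intro K₀ hgap
    by_contra hK
    exact hnz (hgap C K w (not_lt.1 hK) hw hD)
  · -- (2) above every small-constant threshold
    intro ε₀ hε
    by_contra hC
    exact hε C K w (not_lt.1 hC) hw hD hsing
  · -- (3) the near-one threshold
    obtain ⟨c₁, hc₁, H⟩ := exists_pastDss_threshold hw hD hc hpast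
    refine ⟨c₁, hc₁, ?_⟩
    by_contra hcc
    exact hnz (H (not_le.1 hcc))
  · -- (4) infinite L³ norm
    intro t ht
    by_contra h3
    exact hnz (eq_zero_of_pastDss_of_eLpNorm_three_lt_top hw hc hpast ht (lt_top_iff_ne_top.2 h3))
  · -- (5) infinite energy
    intro t ht
    by_contra h2
    exact hnz (eq_zero_of_pastDss_of_eLpNorm_two_lt_top hw hD hc hpast ht (lt_top_iff_ne_top.2 h2))
  · -- (6) unbounded scaled energy
    intro τ E hτ hτ0 hE
    exact hnz (eq_zero_of_scaledEnergy_le_backward hw hD hτ hτ0 hE)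
  · -- (7) nonzero blow-down
    intro t₀ ht₀ hzoom
    exact hnz (eq_zero_of_pastDss_of_blowdown_tendsto_zero hw hD hc hpast ht₀ hzoom)
  · -- (8) not axisymmetric
    intro haxi
    exact hnz (eq_zero_of_pastDss_of_isAxisymmetric hw hD hc hpast haxi)

/-- **The portrait's first clause with the absolute gap constant** of `stub_smallDissipationGap`
(p579719): a singular past-DSS member of the stratum has `K₀ < K`. (The matching `ε₀ < C` follows
from clause (2) with the disprover's `Negative.fdl_of_small_typeI_constant`.) -/
theorem pastDss_singular_gap_lt :
    ∃ K₀ : ℝ, 0 < K₀ ∧ ∀ (C K c : ℝ)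
      (w : ℝ → EuclideanSpace ℝ (Fin 3) → EuclideanSpace ℝ (Fin 3)), IsTypeIAncientMild C w →
      (∀ s : ℝ, s < 0 → ∫⁻ x, ‖fderiv ℝ (w s) x‖ₑ ^ 2 ≤ ENNReal.ofReal (K / Real.sqrt (-s))) →
      1 < c → (∀ t : ℝ, t < 0 → ∀ x, c • w (c ^ 2 * t) (c • x) = w t x) →
      (∀ r > 0, ∀ M : ℝ, ∃ t ∈ Set.Ioo (-(r ^ 2)) (0 : ℝ),
        ∃ x ∈ Metric.ball (0 : EuclideanSpace ℝ (Fin 3)) r, M < ‖w t x‖) →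
      K₀ < K := by
  obtain ⟨K₀, hK₀, hgap⟩ := stub_smallDissipationGap
  refine ⟨K₀, hK₀, fun C K c w hw hD hc hpast hsing => ?_⟩
  obtain ⟨⟨-, h1⟩, -⟩ := pastDss_singular_portrait hw hD hc hpast hsing
  exact h1 K₀ hgap

/-! ### Appended (lead g2, 2026-08-28): the explicit Type-I threshold and the portrait of a
counterexample to the crux itself -/

/-- **Clause (2) made explicit: a singular member of the stratum has Type-I constant `C ≥ 1`.**
The tree's `SimilarityEnstrophy.typeI_ancient_eq_zero_of_rate_lt_one` (route DssFarFieldSlaving,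
theory T31⁗: every Type-I ancient mild field in the KNSS gauge with constant `C < 1` vanishes —
similarity-enstrophy budget, no spatial hypothesis, no dissipation law) is a small-constant
threshold in the sense of clause (2) of `pastDss_singular_portrait`. -/
theorem one_le_typeI_const_of_singular {C : ℝ}
    {w : ℝ → EuclideanSpace ℝ (Fin 3) → EuclideanSpace ℝ (Fin 3)} (hw : IsTypeIAncientMild C w)
    (hsing : ∀ r > 0, ∀ M : ℝ, ∃ t ∈ Set.Ioo (-(r ^ 2)) (0 : ℝ),
      ∃ x ∈ Metric.ball (0 : EuclideanSpace ℝ (Fin 3)) r, M < ‖w t x‖) : 1 ≤ C := by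
  by_contra hC
  exact not_forall_eq_zero_of_singular hsing
    (SimilarityEnstrophy.typeI_ancient_eq_zero_of_rate_lt_one hw (not_le.1 hC))

/-- **Portrait of a counterexample to the crux `FiniteDissipationLiouville` itself** (no
self-similarity assumed). A member of the finite-dissipation Type-I ancient mild stratum
(`IsTypeIAncientMild C w`, quarter law with constant `K`) which is SINGULAR at the apex has:
(1) `1 ≤ C` (`typeI_ancient_eq_zero_of_rate_lt_one`); (2) `0 < K`, indeed `K` above every gap
constant (`eq_zero_of_dissLaw_const_nonpos`, `stub_smallDissipationGap`); (3) no sequence of times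
`τ_k → −∞` along which the slices stay bounded in `L³(ℝ³)` (Albritton–Barker 2019 Thm 1.2,
`eq_zero_of_eLpNorm_three_le_backward`); (4) no sequence `τ_k → −∞` along which the global scaled
energy `(−τ_k)^{-1/2} ∫|w(τ_k)|²` stays bounded (`eq_zero_of_scaledEnergy_le_backward`). -/
theorem fdl_singular_portrait {C K : ℝ}
    {w : ℝ → EuclideanSpace ℝ (Fin 3) → EuclideanSpace ℝ (Fin 3)} (hw : IsTypeIAncientMild C w)
    (hD : ∀ s : ℝ, s < 0 → ∫⁻ x, ‖fderiv ℝ (w s) x‖ₑ ^ 2 ≤ ENNReal.ofReal (K / Real.sqrt (-s)))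
    (hsing : ∀ r > 0, ∀ M : ℝ, ∃ t ∈ Set.Ioo (-(r ^ 2)) (0 : ℝ),
      ∃ x ∈ Metric.ball (0 : EuclideanSpace ℝ (Fin 3)) r, M < ‖w t x‖) :
    1 ≤ C ∧
    (0 < K ∧ ∀ K₀ : ℝ, (∀ (C' K' : ℝ)
        (v : ℝ → EuclideanSpace ℝ (Fin 3) → EuclideanSpace ℝ (Fin 3)), K' ≤ K₀ →
        IsTypeIAncientMild C' v →
        (∀ s : ℝ, s < 0 → ∫⁻ x, ‖fderiv ℝ (v s) x‖ₑ ^ 2 ≤ ENNReal.ofReal (K' / Real.sqrt (-s))) →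
        ∀ t < 0, ∀ x, v t x = 0) → K₀ < K) ∧
    (∀ (τ : ℕ → ℝ) (M : ℝ≥0∞), Tendsto τ atTop atBot → M < ⊤ →
        ¬ ∀ k, eLpNorm (w (τ k)) 3 volume ≤ M) ∧
    (∀ (τ : ℕ → ℝ) (E : ℝ), Tendsto τ atTop atBot → (∀ k, τ k < 0) →
        ¬ ∀ k, ∫⁻ x, ‖w (τ k) x‖ₑ ^ 2 ≤ ENNReal.ofReal (E * Real.sqrt (-τ k))) := by
  have hnz : ¬ ∀ t < 0, ∀ x, w t x = 0 := not_forall_eq_zero_of_singular hsing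
  refine ⟨one_le_typeI_const_of_singular hw hsing, ⟨?_, ?_⟩, ?_, ?_⟩
  · by_contra hK
    exact hnz (eq_zero_of_dissLaw_const_nonpos hw hD (not_lt.1 hK))
  · intro K₀ hgap
    by_contra hK
    exact hnz (hgap C K w (not_lt.1 hK) hw hD)
  · intro τ M hτ hM h3
    exact hnz (eq_zero_of_eLpNorm_three_le_backward hw hτ hM h3)
  · intro τ E hτ hτ0 hE
    exact hnz (eq_zero_of_scaledEnergy_le_backward hw hD hτ hτ0 hE)

/-- The DSS portrait with the explicit threshold: a singular past-DSS member of the stratum has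
`1 ≤ C` and `K₀ < K` for the absolute gap constant. -/
theorem pastDss_singular_explicit_thresholds :
    ∃ K₀ : ℝ, 0 < K₀ ∧ ∀ (C K c : ℝ)
      (w : ℝ → EuclideanSpace ℝ (Fin 3) → EuclideanSpace ℝ (Fin 3)), IsTypeIAncientMild C w →
      (∀ s : ℝ, s < 0 → ∫⁻ x, ‖fderiv ℝ (w s) x‖ₑ ^ 2 ≤ ENNReal.ofReal (K / Real.sqrt (-s))) →
      1 < c → (∀ t : ℝ, t < 0 → ∀ x, c • w (c ^ 2 * t) (c • x) = w t x) →
      (∀ r > 0, ∀ M : ℝ, ∃ t ∈ Set.Ioo (-(r ^ 2)) (0 : ℝ),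
        ∃ x ∈ Metric.ball (0 : EuclideanSpace ℝ (Fin 3)) r, M < ‖w t x‖) →
      1 ≤ C ∧ K₀ < K := by
  obtain ⟨K₀, hK₀, hgap⟩ := pastDss_singular_gap_lt
  exact ⟨K₀, hK₀, fun C K c w hw hD hc hpast hsing =>
    ⟨one_le_typeI_const_of_singular hw hsing, hgap C K c w hw hD hc hpast hsing⟩⟩

end Summit.NavierStokesRegularity.NavierStokesRegularity.Theorems.FiniteDissipationLiouville.Birth

end
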